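import Mathlib.Analysis.Convex.Topology
import Mathlib.Topology.MetricSpace.Bounded
import Literature.Probability.LatticeModels.MeshColumns
import HarnessLib

/-!
# Full and perfect mesh cells of a planar domain

Topic: Probability / LatticeModels (second file of the "bulk = largest mesh component for every
Jordan domain" theorem, `MeshDomainJordan.lean`). For an open set `Ω ⊆ ℂ` and mesh `δ > 0`:

* `IsFull Ω δ k j` — the open cell `(k, j)` lies in `Ω`; then its closure lies in `Ω̄`, so it
  misses the exterior `(Ω̄)ᶜ`, and any two adjacent corners that are mesh vertices are joined in
  the mesh graph (`meshGraph_adj_corner_*`).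
* `IsPerfect Ω δ k j` — full, and the four corners are mesh vertices; the corners of a perfect
  cell, and of a vertical run of perfect cells, are mutually reachable in the mesh graph on mesh
  vertices (`reachable_corner_of_isPerfect`, `reachable_of_perfect_run`) — the "ladder".
* Exterior points (this is where `∂Ω ⊆ closure (Ω̄)ᶜ` enters, true for Jordan domains): a cell
  that is not full contains an exterior point (`exists_mem_cell_exterior_of_not_isFull`); next to
  a lattice point of `∂Ω` there is an exterior point inside one of the four open cells at that
  point (`exists_exterior_cell_near`), reached from it by an open segment inside that cell.
* Book-keeping for the counting argument: far cells are not full (`abs_lt_of_isFull`), the ball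
  of radius `δ/2` about the centre lies in the cell, and a full cell with a corner close to `Ωᶜ`
  lies in the inner collar (`infDist_lt_of_mem_cell`).

Folklore lattice geometry. Mathlib anchors: `Convex.openSegment_closure_interior_subset_interior`,
`mem_closure_iff_nhds'`, `Metric.infDist`, `SimpleGraph.induce`. H21 anchors: `Mesh.cell`,
`Mesh.corner`, `Mesh.cellCenter` (`MeshColumns.lean`, sub-namespace `…LatticeModels.Mesh`, which this
file continues), `meshGraph`, `meshVertexGraph`, `meshVertices` (`DomainDiscretisation.lean`).
-/

namespace Literature.Probability.LatticeModels.Mesh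

open Set Complex Metric

noncomputable section

variable {Ω : Set ℂ} {δ : ℝ} {k j : ℤ}

/-! ### Full cells -/

/-- The cell `(k, j)` of the mesh `δℤ²` is *full* if the open square lies in `Ω`. [folklore] -/
def IsFull (Ω : Set ℂ) (δ : ℝ) (k j : ℤ) : Prop := cell δ k j ⊆ Ω

/-- The cell `(k, j)` is *perfect* if it is full and its four corners are mesh vertices (their
mesh points lie in `Ω`). [folklore] -/
def IsPerfect (Ω : Set ℂ) (δ : ℝ) (k j : ℤ) : Prop :=
  IsFull Ω δ k j ∧ ∀ a b : Bool, corner k j a b ∈ meshVertices Ω δ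

/-- The closure of a full cell lies in `Ω̄`. [folklore] -/
theorem IsFull.closure_subset (h : IsFull Ω δ k j) : closure (cell δ k j) ⊆ closure Ω :=
  closure_mono h

/-- A full cell's closure misses the exterior `(Ω̄)ᶜ`. [folklore] -/
theorem IsFull.disjoint_closure_exterior (h : IsFull Ω δ k j) :
    Disjoint (closure (cell δ k j)) (closure Ω)ᶜ :=
  disjoint_compl_right.mono_left h.closure_subset

/-- In a full cell, a closed segment between two corners lies in `Ω̄`. [folklore] -/
theorem IsFull.segment_corner_subset (hδ : 0 < δ) (h : IsFull Ω δ k j) (a b a' b' : Bool) :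
    segment ℝ (meshPoint δ (corner k j a b)) (meshPoint δ (corner k j a' b')) ⊆ closure Ω :=
  (segment_corner_subset_closure_cell hδ k j a b a' b').trans h.closure_subset

/-- In a full cell, horizontally adjacent corners are joined in the mesh graph. [folklore] -/
theorem IsFull.meshGraph_adj_horizontal (hδ : 0 < δ) (h : IsFull Ω δ k j) (b : Bool) :
    (meshGraph Ω δ).Adj (corner k j false b) (corner k j true b) :=
  meshGraph_adj_iff.2 ⟨zdGraph_adj_corner_horizontal k j b, h.segment_corner_subset hδ _ _ _ _⟩

/-- In a full cell, vertically adjacent corners are joined in the mesh graph. [folklore] -/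
theorem IsFull.meshGraph_adj_vertical (hδ : 0 < δ) (h : IsFull Ω δ k j) (a : Bool) :
    (meshGraph Ω δ).Adj (corner k j a false) (corner k j a true) :=
  meshGraph_adj_iff.2 ⟨zdGraph_adj_corner_vertical k j a, h.segment_corner_subset hδ _ _ _ _⟩

/-! ### Perfect cells and ladders -/

/-- Adjacency in the mesh graph on mesh vertices is adjacency in the mesh graph. [folklore] -/
theorem meshVertexGraph_adj_iff {x y : Site 2} (hx : x ∈ meshVertices Ω δ)
    (hy : y ∈ meshVertices Ω δ) :
    (meshVertexGraph Ω δ).Adj ⟨x, hx⟩ ⟨y, hy⟩ ↔ (meshGraph Ω δ).Adj x y :=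
  Iff.rfl

/-- In a perfect cell every corner is reachable, in the mesh graph on mesh vertices, from the
lower-left corner. [folklore] -/
theorem reachable_corner_of_isPerfect (hδ : 0 < δ) (h : IsPerfect Ω δ k j) (a b : Bool) :
    (meshVertexGraph Ω δ).Reachable ⟨corner k j false false, h.2 false false⟩
      ⟨corner k j a b, h.2 a b⟩ := by
  have hh : ∀ b, (meshVertexGraph Ω δ).Adj ⟨corner k j false b, h.2 false b⟩
      ⟨corner k j true b, h.2 true b⟩ := fun b =>
    (meshVertexGraph_adj_iff _ _).2 (h.1.meshGraph_adj_horizontal hδ b)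
  have hv : ∀ a, (meshVertexGraph Ω δ).Adj ⟨corner k j a false, h.2 a false⟩
      ⟨corner k j a true, h.2 a true⟩ := fun a =>
    (meshVertexGraph_adj_iff _ _).2 (h.1.meshGraph_adj_vertical hδ a)
  cases a <;> cases b
  · rfl
  · exact (hv false).reachable
  · exact (hh false).reachable
  · exact (hh false).reachable.trans (hv true).reachable

/-- **Ladder.** In a vertical run of perfect cells `(k, j₁), …, (k, j₁ + n)`, every corner of
every cell of the run is reachable from the lower-left corner of the bottom cell. [folklore] -/
theorem reachable_of_perfect_run (hδ : 0 < δ) {k j₁ : ℤ} {n : ℕ}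
    (h : ∀ m : ℕ, m ≤ n → IsPerfect Ω δ k (j₁ + m)) {m : ℕ} (hm : m ≤ n) (a b : Bool) :
    (meshVertexGraph Ω δ).Reachable
      ⟨corner k j₁ false false, by simpa using (h 0 (Nat.zero_le _)).2 false false⟩
      ⟨corner k (j₁ + m) a b, (h m hm).2 a b⟩ := by
  induction m generalizing a b with
  | zero =>
    have := reachable_corner_of_isPerfect hδ (h 0 (Nat.zero_le _)) a b
    simpa using this
  | succ m ih =>
    have hm' : m ≤ n := (Nat.le_succ m).trans hm
    -- climb to the top-left corner of cell `j₁ + m`, which is the bottom-left corner of the next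
    have h1 := ih hm' false true
    have heq : corner k (j₁ + m) false true = corner k (j₁ + (m + 1 : ℕ)) false false := by
      rw [corner_top_eq]; push_cast; ring_nf
    have h2 := reachable_corner_of_isPerfect hδ (h (m + 1) hm) a b
    have hmem : corner k (j₁ + m) false true ∈ meshVertices Ω δ := (h m hm').2 false true
    have : (⟨corner k (j₁ + m) false true, hmem⟩ : meshVertices Ω δ) =
        ⟨corner k (j₁ + (m + 1 : ℕ)) false false, (h (m+1) hm).2 false false⟩ := by
      exact Subtype.ext heq
    rw [this] at h1
    exact h1.trans h2

/-! ### Exterior points in and near cells -/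

/-- A point of `Ω̄ \ Ω` (for open `Ω`) is a frontier point. [folklore] -/
theorem mem_frontier_of_mem_closure (hΩo : IsOpen Ω) {z : ℂ} (hz : z ∈ closure Ω) (hz' : z ∉ Ω) :
    z ∈ frontier Ω := by
  rw [frontier, hΩo.interior_eq]
  exact ⟨hz, hz'⟩

/-- If `∂Ω ⊆ closure (Ω̄)ᶜ` (true for Jordan domains), an open set meeting `Ωᶜ` meets the
exterior. [folklore] -/
theorem exists_mem_exterior_of_isOpen (hΩo : IsOpen Ω) (hJE : frontier Ω ⊆ closure (closure Ω)ᶜ)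
    {U : Set ℂ} (hU : IsOpen U) {z : ℂ} (hzU : z ∈ U) (hzΩ : z ∉ Ω) :
    ∃ x ∈ U, x ∈ (closure Ω)ᶜ := by
  by_cases hz : z ∈ closure Ω
  · have hzf := mem_frontier_of_mem_closure hΩo hz hzΩ
    have := hJE hzf
    rw [mem_closure_iff_nhds'] at this
    obtain ⟨⟨x, hxE⟩, hxU⟩ := this U (hU.mem_nhds hzU)
    exact ⟨x, hxU, hxE⟩
  · exact ⟨z, hzU, hz⟩

/-- **A cell that is not full contains an exterior point** (for open `Ω` with
`∂Ω ⊆ closure (Ω̄)ᶜ`). [folklore] -/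
theorem exists_mem_cell_exterior_of_not_isFull (hΩo : IsOpen Ω)
    (hJE : frontier Ω ⊆ closure (closure Ω)ᶜ) {k j : ℤ} (h : ¬ IsFull Ω δ k j) :
    ∃ x ∈ cell δ k j, x ∈ (closure Ω)ᶜ := by
  obtain ⟨z, hz, hzΩ⟩ := not_subset.1 h
  exact exists_mem_exterior_of_isOpen hΩo hJE (isOpen_cell δ k j) hz hzΩ

/-- A full cell that is not perfect has a corner off `Ω`, which is then a frontier point.
[folklore] -/
theorem exists_corner_mem_frontier (hΩo : IsOpen Ω) (hδ : 0 < δ) {k j : ℤ} (hf : IsFull Ω δ k j)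
    (hp : ¬ IsPerfect Ω δ k j) :
    ∃ a b : Bool, meshPoint δ (corner k j a b) ∈ frontier Ω := by
  simp only [IsPerfect, not_and, not_forall] at hp
  obtain ⟨a, b, hab⟩ := hp hf
  exact ⟨a, b, mem_frontier_of_mem_closure hΩo
    (hf.closure_subset (meshPoint_corner_mem_closure_cell hδ k j a b)) hab⟩

/-- Moving a real number away from `c` by `r > 0` in the direction it already lies. [folklore] -/
theorem abs_moveAway {t c r : ℝ} (hr : 0 < r) :
    r ≤ |(if c ≤ t then t + r else t - r) - c| ∧ |(if c ≤ t then t + r else t - r) - t| = r := by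
  split_ifs with h
  · constructor
    · rw [abs_of_nonneg (by linarith)]; linarith
    · rw [show t + r - t = r by ring, abs_of_pos hr]
  · push Not at h
    constructor
    · rw [abs_of_neg (by linarith)]; linarith
    · rw [show t - r - t = -r by ring, abs_neg, abs_of_pos hr]

/-- A real number within `δ` of `δ n` and different from it lies strictly inside one of the two
adjacent mesh intervals. [folklore] -/
theorem exists_mem_Ioo_of_abs_lt {t : ℝ} {n : ℤ} (h : |t - δ * n| < δ) (hne : t ≠ δ * n) :
    ∃ m : ℤ, (m = n - 1 ∨ m = n) ∧ t ∈ Ioo (δ * m) (δ * (m + 1)) := by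
  rw [abs_lt] at h
  rcases hne.lt_or_gt with hlt | hgt
  · exact ⟨n - 1, Or.inl rfl, by push_cast; linarith, by push_cast; linarith⟩
  · exact ⟨n, Or.inr rfl, hgt, by linarith⟩

/-- **Exterior points next to a lattice point of the boundary.** If the mesh point `κ` of a site
`v` lies in the closure of the exterior, then some open cell having `κ` as a corner contains an
exterior point within `δ/2` of `κ` (`δ > 0`). [folklore] -/
theorem exists_exterior_cell_near (hδ : 0 < δ) {v : Site 2}
    (hv : meshPoint δ v ∈ closure (closure Ω)ᶜ) :
    ∃ (k' j' : ℤ) (x : ℂ), (k' = v 0 - 1 ∨ k' = v 0) ∧ (j' = v 1 - 1 ∨ j' = v 1) ∧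
      x ∈ cell δ k' j' ∧ x ∈ (closure Ω)ᶜ ∧ dist x (meshPoint δ v) < δ / 2 := by
  -- an exterior point `e` near `κ`, with a small ball in the exterior
  rw [Metric.mem_closure_iff] at hv
  obtain ⟨e, heE, hed⟩ := hv (δ / 8) (by positivity)
  have hEo : IsOpen (closure Ω)ᶜ := isClosed_closure.isOpen_compl
  obtain ⟨r, hr, hball⟩ := Metric.isOpen_iff.1 hEo e heE
  set ρ : ℝ := min (r / 4) (δ / 16) with hρ
  have hρpos : 0 < ρ := lt_min (by positivity) (by positivity)
  have hρr : ρ ≤ r / 4 := min_le_left _ _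
  have hρδ : ρ ≤ δ / 16 := min_le_right _ _
  -- move both coordinates of `e` away from those of `κ` by `ρ`
  set κ := meshPoint δ v with hκ
  obtain ⟨hxr1, hxr2⟩ := abs_moveAway (t := e.re) (c := κ.re) hρpos
  obtain ⟨hxi1, hxi2⟩ := abs_moveAway (t := e.im) (c := κ.im) hρpos
  set xr : ℝ := if κ.re ≤ e.re then e.re + ρ else e.re - ρ with hxr
  set xi : ℝ := if κ.im ≤ e.im then e.im + ρ else e.im - ρ with hxi
  set x : ℂ := ⟨xr, xi⟩ with hx
  have hxe : dist x e < r := by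
    rw [Complex.dist_eq]
    refine (norm_le_abs_re_add_abs_im _).trans_lt ?_
    simp only [sub_re, sub_im]
    change |xr - e.re| + |xi - e.im| < r
    rw [hxr2, hxi2]
    linarith
  have hxE : x ∈ (closure Ω)ᶜ := hball (mem_ball.2 hxe)
  have hed' : dist e κ < δ / 8 := by rwa [dist_comm] at hed
  have hre_e : |e.re - κ.re| < δ / 8 :=
    (abs_re_le_norm (e - κ)).trans_lt (by rwa [← Complex.dist_eq])
  have him_e : |e.im - κ.im| < δ / 8 :=
    (abs_im_le_norm (e - κ)).trans_lt (by rwa [← Complex.dist_eq])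
  -- the coordinates of `x` are within `δ/8 + ρ ≤ 3δ/16` of those of `κ`, and differ from them
  have h1 : |xr - κ.re| < ρ + δ / 8 := by
    calc |xr - κ.re| = |(xr - e.re) + (e.re - κ.re)| := by ring_nf
      _ ≤ |xr - e.re| + |e.re - κ.re| := abs_add_le _ _
      _ < ρ + δ / 8 := by rw [hxr2]; linarith
  have h2 : |xi - κ.im| < ρ + δ / 8 := by
    calc |xi - κ.im| = |(xi - e.im) + (e.im - κ.im)| := by ring_nf
      _ ≤ |xi - e.im| + |e.im - κ.im| := abs_add_le _ _
      _ < ρ + δ / 8 := by rw [hxi2]; linarith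
  have hxr_lt : |xr - κ.re| < δ / 2 := by linarith
  have hxi_lt : |xi - κ.im| < δ / 2 := by linarith
  have hxr_ne : xr ≠ κ.re := fun h => by
    rw [h, sub_self, abs_zero] at hxr1; linarith
  have hxi_ne : xi ≠ κ.im := fun h => by
    rw [h, sub_self, abs_zero] at hxi1; linarith
  have hκre : κ.re = δ * v 0 := meshPoint_re δ v
  have hκim : κ.im = δ * v 1 := meshPoint_im δ v
  obtain ⟨k', hk', hk'mem⟩ := exists_mem_Ioo_of_abs_lt (δ := δ) (n := v 0) (t := xr)
    (by rw [← hκre]; linarith [hxr_lt]) (by rwa [← hκre])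
  obtain ⟨j', hj', hj'mem⟩ := exists_mem_Ioo_of_abs_lt (δ := δ) (n := v 1) (t := xi)
    (by rw [← hκim]; linarith [hxi_lt]) (by rwa [← hκim])
  refine ⟨k', j', x, hk', hj', ⟨hk'mem, hj'mem⟩, hxE, ?_⟩
  rw [Complex.dist_eq]
  refine (norm_le_abs_re_add_abs_im _).trans_lt ?_
  simp only [sub_re, sub_im]
  change |xr - κ.re| + |xi - κ.im| < δ / 2
  linarith

/-- A lattice point adjacent to a cell (one of its four corners, seen from the cell named by an
offset as in `exists_exterior_cell_near`) is a corner of that cell. [folklore] -/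
theorem exists_corner_eq_of_offset {v : Site 2} {k' j' : ℤ} (hk' : k' = v 0 - 1 ∨ k' = v 0)
    (hj' : j' = v 1 - 1 ∨ j' = v 1) : ∃ a b : Bool, corner k' j' a b = v := by
  rcases hk' with rfl | rfl <;> rcases hj' with rfl | rfl
  · exact ⟨true, true, by funext l; fin_cases l <;> simp [corner]⟩
  · exact ⟨true, false, by funext l; fin_cases l <;> simp [corner]⟩
  · exact ⟨false, true, by funext l; fin_cases l <;> simp [corner]⟩
  · exact ⟨false, false, by funext l; fin_cases l <;> simp [corner]⟩

/-- **Open segments from a corner into the cell.** The open segment from a corner of a cell to a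
point of the (open, convex) cell lies in the cell. [folklore] -/
theorem openSegment_corner_subset_cell (hδ : 0 < δ) (k j : ℤ) (a b : Bool) {x : ℂ}
    (hx : x ∈ cell δ k j) : openSegment ℝ (meshPoint δ (corner k j a b)) x ⊆ cell δ k j := by
  have h := (convex_cell δ k j).openSegment_closure_interior_subset_interior
    (meshPoint_corner_mem_closure_cell hδ k j a b) (by rwa [(isOpen_cell δ k j).interior_eq])
  rwa [(isOpen_cell δ k j).interior_eq] at h

/-- The open segment from a point of a cell to a point of its closure lies in the cell. [folklore] -/
theorem openSegment_subset_cell_of_mem_closure (k j : ℤ) {x z : ℂ} (hx : x ∈ cell δ k j)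
    (hz : z ∈ closure (cell δ k j)) : openSegment ℝ x z ⊆ cell δ k j := by
  have h := (convex_cell δ k j).openSegment_interior_closure_subset_interior
    (by rwa [(isOpen_cell δ k j).interior_eq]) hz
  rwa [(isOpen_cell δ k j).interior_eq] at h

/-! ### Book-keeping for the counting argument -/

/-- The ball of radius `δ/2` about the centre lies in the cell. [folklore] -/
theorem ball_cellCenter_subset_cell (δ : ℝ) (k j : ℤ) :
    ball (cellCenter δ k j) (δ / 2) ⊆ cell δ k j := by
  intro z hz
  rw [mem_ball, Complex.dist_eq] at hz
  have hre := (abs_re_le_norm (z - cellCenter δ k j)).trans_lt hz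
  have him := (abs_im_le_norm (z - cellCenter δ k j)).trans_lt hz
  rw [sub_re, cellCenter_re, abs_lt] at hre
  rw [sub_im, cellCenter_im, abs_lt] at him
  refine ⟨⟨?_, ?_⟩, ?_, ?_⟩ <;> nlinarith

/-- Points of a cell are within `2δ` of each of its corners (`δ > 0`). [folklore] -/
theorem dist_corner_lt_of_mem_cell (hδ : 0 < δ) {k j : ℤ} {z : ℂ} (hz : z ∈ cell δ k j) (a b : Bool) :
    dist z (meshPoint δ (corner k j a b)) < 2 * δ := by
  obtain ⟨⟨h1, h2⟩, h3, h4⟩ := hz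
  have ha := ite_cast_mem_unit a
  have hb := ite_cast_mem_unit b
  rw [Complex.dist_eq]
  refine (norm_le_abs_re_add_abs_im _).trans_lt ?_
  rw [sub_re, sub_im, meshPoint_re, meshPoint_im, corner_zero, corner_one]
  push_cast
  have hre : |z.re - δ * (↑k + ((if a = true then 1 else 0 : ℤ) : ℝ))| < δ := by
    rw [abs_lt]; constructor <;> nlinarith
  have him : |z.im - δ * (↑j + ((if b = true then 1 else 0 : ℤ) : ℝ))| < δ := by
    rw [abs_lt]; constructor <;> nlinarith
  push_cast at hre him
  linarith

/-- **A full cell with a corner near `Ωᶜ` lies in the inner collar**: if a corner is at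
distance `< ε` from `Ωᶜ` then every point of the cell is at distance `< ε + 2δ`. [folklore] -/
theorem infDist_lt_of_mem_cell (hδ : 0 < δ) {k j : ℤ} {a b : Bool} {ε : ℝ}
    (hκ : infDist (meshPoint δ (corner k j a b)) Ωᶜ < ε) {z : ℂ} (hz : z ∈ cell δ k j) :
    infDist z Ωᶜ < ε + 2 * δ := by
  have h := infDist_le_infDist_add_dist (s := Ωᶜ) (x := z) (y := meshPoint δ (corner k j a b))
  have hd := dist_corner_lt_of_mem_cell hδ hz a b
  linarith

/-- **Far cells are not full**: if `Ω ⊆ closedBall 0 R` then a full cell has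
`δ |j| ≤ R + δ` and `δ |k| ≤ R + δ` (`δ > 0`). [folklore] -/
theorem mul_abs_le_of_isFull (hδ : 0 < δ) {R : ℝ} (hR : Ω ⊆ closedBall (0 : ℂ) R) {k j : ℤ}
    (h : IsFull Ω δ k j) : δ * |(j : ℝ)| ≤ R + δ ∧ δ * |(k : ℝ)| ≤ R + δ := by
  have hc : cellCenter δ k j ∈ closedBall (0 : ℂ) R := hR (h (cellCenter_mem_cell hδ k j))
  rw [mem_closedBall, dist_zero_right] at hc
  have hre := (abs_re_le_norm (cellCenter δ k j)).trans hc
  have him := (abs_im_le_norm (cellCenter δ k j)).trans hc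
  rw [cellCenter_re] at hre
  rw [cellCenter_im] at him
  constructor
  · have : δ * |(j : ℝ)| ≤ |δ * (j + 1 / 2)| + δ / 2 := by
      rw [abs_mul, abs_of_pos hδ]
      have := abs_sub_abs_le_abs_sub (j : ℝ) (j + 1 / 2)
      rw [show (j : ℝ) - (j + 1 / 2) = -(1 / 2) by ring, abs_neg,
        abs_of_pos (by norm_num : (0 : ℝ) < 1 / 2)] at this
      nlinarith
    linarith
  · have : δ * |(k : ℝ)| ≤ |δ * (k + 1 / 2)| + δ / 2 := by
      rw [abs_mul, abs_of_pos hδ]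
      have := abs_sub_abs_le_abs_sub (k : ℝ) (k + 1 / 2)
      rw [show (k : ℝ) - (k + 1 / 2) = -(1 / 2) by ring, abs_neg,
        abs_of_pos (by norm_num : (0 : ℝ) < 1 / 2)] at this
      nlinarith
    linarith

end

end Literature.Probability.LatticeModels.Mesh
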